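import Mathlib
import Summits.ValiantsHypothesis.ValiantsHypothesis.Theses.FreeFermionCLL
import Summits.ValiantsHypothesis.ValiantsHypothesis.Theorems.FreeFermionCLLExpImpliesGap

/-!
# Line `read-once-seam` for the crux `PMCorrelationGap` (stmt-ValiantsHypothesis-13555, route FreeFermionCLL)

Crux-strategist line (seat `planner-cstrat-stmt-ValiantsHypothesis-13555-r1-0`, 2026-08-17): the
crux-strategist's GLUED SPLIT of the deciding crux along the read-once seam, made into one
kernel-checked skeleton with FOUR registered stubs and the composition `PMCorrelationGap_of`.

    stub_subMult ─┐(Fekete)                                   stub_amplify ─┐(symmetrisation)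
                  ├─► FreeFermionQPDecay ─┐                                  ├─► ColourMerging ─┐
    stub_thresholdHalf ┘                  │     stub_goodCorrelatorsForceFF ┘                 │
                                          └────────── pmCorrelationGap_of_subs (qp glue) ◄──────┘
                                                              │
                                                              ▼
                                   Theses.FreeFermionCLL.PMCorrelationGap  (by name)

* §1 quasi-polynomial bookkeeping and the glue `pmCorrelationGap_of_subs :
  FreeFermionQPDecay → ColourMerging → PMCorrelationGap` (= Cruxes/PMCorrelationGap/StrategySplit.lean,
  repeated here because crux workfiles are not importable on the farm), plus
  `freeFermionQPDecay_of_readOnceDecay : ReadOnceDecay → FreeFermionQPDecay` (the route's rank-2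
  crux closes child 1);
* §2 the FEKETE LINE for child 1 (`FreeFermionQPDecay`: free-fermion overlap decays faster than
  every quasi-polynomial): `stub_subMult` (sub-multiplicativity of `s(n) = sup_K permCorrSq(FF_K^(n))`
  over board sizes — hardest of the two), `stub_thresholdHalf` (one level `n₀ ≥ 1` with
  `s(n₀) ≤ 1/2` — finite/computational), composition `freeFermionQPDecay_of` (Fekete + `(log₂ n + c)^c ≤
  n/n₀` eventually);
* §3 the AMPLIFICATION LINE for child 2 (`ColourMerging`, power form): `stub_amplify`
  (symmetrisation under the stabiliser of `per_n`: `k·ρ·(1−ρ̃) ≤ 1−ρ` at rank `≤ (k(R+n+2))^B`,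
  structural), `stub_goodCorrelatorsForceFF` (a form at angle ≤ 45° from `per_n` forces free-fermion
  overlap `≥ 1/(C(R+n+1)^C)` — THE OPEN CONTENT, hardest stub of the line), composition
  `colourMerging_of` (amplify with `k = ⌈2/ρ⌉`, unwind; the power is `A = B·C`);
* §4 `PMCorrelationGap_of : PMCorrelationGap` from the four stubs (and `xStatement_of_stubs`, the same
  with the stub statements as explicit hypotheses, concluding the verbatim copy `XStatement`).

`lean check`: rc 0, sorries = 4 = the stubs, nothing else. Probes (seat folder `bc/`): every
`stub → PMCorrelationGap`, `stub → ValiantsHypothesis`, `piece → PMCorrelationGap`, `piece →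
ValiantsHypothesis` and the converses FAIL under `first | exact? | simpa | aesop`.
-/

set_option linter.dupNamespace false

namespace Summit.ValiantsHypothesis.ValiantsHypothesis.Cruxes.PMCorrelationGap.ReadOnceSeam

open Filter Topology
open Literature.Computability.AlgebraicComplexity
open Summit.ValiantsHypothesis.ValiantsHypothesis.Theses.FreeFermionCLL

/-- Child 1 of the split, verbatim (becomes `Theses.FreeFermionCLL.FreeFermionQPDecay` when the
split is enacted). -/
def FreeFermionQPDecay : Prop :=
  ∀ c : ℕ, ∃ n₀ : ℕ, ∀ n ≥ n₀, ∀ (K : Matrix (Fin n × Fin n) (Fin n × Fin n) ℂ), (2 : ℝ) ^ ((Nat.log 2 n + c) ^ c) * ‖Literature.Computability.AlgebraicComplexity.permMass n (MvPolynomial.homogeneousComponent n (1 + Matrix.diagonal (fun e : Fin n × Fin n => MvPolynomial.X e) * K.map (fun a : ℂ => (MvPolynomial.C a : MvPolynomial (Fin n × Fin n) ℂ))).det)‖ ^ 2 ≤ (n.factorial : ℝ) * Literature.Computability.AlgebraicComplexity.coeffNormSq n (MvPolynomial.homogeneousComponent n (1 + Matrix.diagonal (fun e : Fin n × Fin n =>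 MvPolynomial.X e) * K.map (fun a : ℂ => (MvPolynomial.C a : MvPolynomial (Fin n × Fin n) ℂ))).det)

/-- Child 2 of the split, verbatim (becomes `Theses.FreeFermionCLL.ColourMerging`). -/
def ColourMerging : Prop :=
  ∃ A C : ℕ, ∀ (n R : ℕ) (K : Matrix (Fin R) (Fin R) ℂ) (κ : Fin R → Fin n × Fin n), ∃ K' : Matrix (Fin n × Fin n) (Fin n × Fin n) ℂ, Literature.Computability.AlgebraicComplexity.permCorrSq n (MvPolynomial.homogeneousComponent n (1 + Matrix.diagonal (fun i => MvPolynomial.X (κ i)) * K.map (fun a : ℂ => (MvPolynomial.C a : MvPolynomial (Fin n × Fin n) ℂ))).det) ^ (A + 1) ≤ (C : ℝ) * ((R : ℝ) + n + 1) ^ C * Literature.Computability.AlgebraicComplexity.permCorrSq n (MvPolynomial.homogeneousComponent n (1 + Matrix.diagonal (fun e : Fin n × Fin n => MvPolynomial.X e) * K'.map (fun a : ℂ => (MvPolynomial.C a : MvPolynomial (Fin n × Fin n) ℂ))).det)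

/-- The crux `PMCorrelationGap`, verbatim (the glue below concludes this copy, so that the ONLY
theorem of the file concluding the route decl by name is the stub composition `PMCorrelationGap_of`). -/
def XStatement : Prop :=
  ∀ c : ℕ, ∃ n₀ : ℕ, ∀ n ≥ n₀, ∀ R ≤ 2 ^ ((Nat.log 2 n + c) ^ c), ∀ (K : Matrix (Fin R) (Fin R) ℂ) (κ : Fin R → Fin n × Fin n), 2 * ‖Literature.Computability.AlgebraicComplexity.permMass n (MvPolynomial.homogeneousComponent n (1 + Matrix.diagonal (fun i => MvPolynomial.X (κ i)) * K.map (fun a : ℂ => (MvPolynomial.C a : MvPolynomial (Fin n × Fin n) ℂ))).det)‖ ^ 2 ≤ (n.factorial : ℝ) * Literature.Computability.AlgebraicComplexity.coeffNormSq n (MvPolynomial.homogeneousComponent n (1 + Matrix.diagonal (fun i => MvPolynomial.X (κ i)) * K.map (fun a : ℂ => (MvPolynomial.C a : MvPolynomial (Fin n × Fin n) ℂ))).det)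

/-- The copy is the crux (definitional). -/
theorem xStatement_iff : XStatement ↔ PMCorrelationGap := Iff.rfl

/-! ## §1 Quasi-polynomial bookkeeping and the glue -/


/-- `m · (L + d)^d ≤ (L + (d + m))^(d + m)` for `1 ≤ m`: a natural multiple of a quasi-polynomial
exponent is absorbed by raising the constant. -/
theorem mul_qpExp_le (m d L : ℕ) (hm : 1 ≤ m) :
    m * (L + d) ^ d ≤ (L + (d + m)) ^ (d + m) := by
  have h1 : (L + d) ^ d ≤ (L + (d + m)) ^ d := Nat.pow_le_pow_left (by omega) d
  have h2 : m ≤ (L + (d + m)) ^ m := by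
    calc m ≤ L + (d + m) := by omega
      _ = (L + (d + m)) ^ 1 := (pow_one _).symm
      _ ≤ (L + (d + m)) ^ m := Nat.pow_le_pow_right (by omega) hm
  calc m * (L + d) ^ d ≤ (L + (d + m)) ^ m * (L + (d + m)) ^ d :=
        Nat.mul_le_mul h2 h1
    _ = (L + (d + m)) ^ (d + m) := by rw [← pow_add, Nat.add_comm m d]

/-- The exponent bookkeeping of the glue: with `a = (L + c)^c`,
`A + 1 + 2C + C·a + C·L ≤ (L + c')^c'` for `c' = c + A + 4C + 2`. -/
theorem glue_exponent_le (A C c L : ℕ) :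
    A + 1 + 2 * C + C * (L + c) ^ c + C * L ≤ (L + (c + A + 4 * C + 2)) ^ (c + A + 4 * C + 2) := by
  set d := c + 1 with hd
  have hbase : 1 ≤ L + d := by omega
  have ha : (L + c) ^ c ≤ (L + d) ^ d := by
    calc (L + c) ^ c ≤ (L + d) ^ c := Nat.pow_le_pow_left (by omega) c
      _ ≤ (L + d) ^ d := Nat.pow_le_pow_right hbase (by omega)
  have hL : L ≤ (L + d) ^ d := by
    calc L ≤ L + d := by omega
      _ = (L + d) ^ 1 := (pow_one _).symm
      _ ≤ (L + d) ^ d := Nat.pow_le_pow_right hbase (by omega)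
  have h1 : 1 ≤ (L + d) ^ d := Nat.one_le_pow _ _ hbase
  set m := A + 1 + 4 * C with hm
  have hsum : A + 1 + 2 * C + C * (L + c) ^ c + C * L ≤ m * (L + d) ^ d := by
    have e1 : (A + 1 + 2 * C) * 1 ≤ (A + 1 + 2 * C) * (L + d) ^ d := Nat.mul_le_mul_left _ h1
    have e2 : C * (L + c) ^ c ≤ C * (L + d) ^ d := Nat.mul_le_mul_left _ ha
    have e3 : C * L ≤ C * (L + d) ^ d := Nat.mul_le_mul_left _ hL
    calc A + 1 + 2 * C + C * (L + c) ^ c + C * L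
        ≤ (A + 1 + 2 * C) * (L + d) ^ d + C * (L + d) ^ d + C * (L + d) ^ d := by
          simpa using Nat.add_le_add (Nat.add_le_add e1 e2) e3
      _ = m * (L + d) ^ d := by rw [hm]; ring
  calc A + 1 + 2 * C + C * (L + c) ^ c + C * L ≤ m * (L + d) ^ d := hsum
    _ ≤ (L + (d + m)) ^ (d + m) := mul_qpExp_le m d L (by omega)
    _ = (L + (c + A + 4 * C + 2)) ^ (c + A + 4 * C + 2) := by
        have : d + m = c + A + 4 * C + 2 := by omega
        rw [this]

/-- For `1 ≤ p` and `1 ≤ q`: `2^p + 2^q ≤ 2^(p+q)`. -/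
theorem two_pow_add_two_pow_le (p q : ℕ) (hp : 1 ≤ p) (hq : 1 ≤ q) :
    2 ^ p + 2 ^ q ≤ 2 ^ (p + q) := by
  have h2p : 2 ≤ 2 ^ p := by
    calc 2 = 2 ^ 1 := by norm_num
      _ ≤ 2 ^ p := Nat.pow_le_pow_right (by norm_num) hp
  have h2q : 2 ≤ 2 ^ q := by
    calc 2 = 2 ^ 1 := by norm_num
      _ ≤ 2 ^ q := Nat.pow_le_pow_right (by norm_num) hq
  rw [pow_add]
  nlinarith

/-- The glue's natural-number inequality: for all `A C c n`,
`2^(A+1) · C · (2^((log₂ n + c)^c) + n + 1)^C ≤ 2^((log₂ n + c')^c')` with `c' = c + A + 4C + 2`. -/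
theorem glue_nat_bound (A C c n : ℕ) :
    2 ^ (A + 1) * C * (2 ^ ((Nat.log 2 n + c) ^ c) + n + 1) ^ C ≤
      2 ^ ((Nat.log 2 n + (c + A + 4 * C + 2)) ^ (c + A + 4 * C + 2)) := by
  set L := Nat.log 2 n with hL
  set a := (L + c) ^ c with ha
  have hn : n < 2 ^ (L + 1) := Nat.lt_pow_succ_log_self (by norm_num) n
  have ha1 : 1 ≤ a := by
    rcases Nat.eq_zero_or_pos c with h | h
    · simp [ha, h]
    · exact Nat.one_le_pow _ _ (by omega)
  -- `2^a + n + 1 ≤ 2^(a + L + 1)`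
  have hbase : 2 ^ a + n + 1 ≤ 2 ^ (a + (L + 1)) := by
    calc 2 ^ a + n + 1 ≤ 2 ^ a + 2 ^ (L + 1) := by omega
      _ ≤ 2 ^ (a + (L + 1)) := two_pow_add_two_pow_le a (L + 1) ha1 (by omega)
  have hpow : (2 ^ a + n + 1) ^ C ≤ 2 ^ (C * (a + L + 1)) := by
    calc (2 ^ a + n + 1) ^ C ≤ (2 ^ (a + (L + 1))) ^ C := Nat.pow_le_pow_left hbase C
      _ = 2 ^ (C * (a + L + 1)) := by rw [← pow_mul]; ring_nf
  have hC : C ≤ 2 ^ C := (Nat.lt_two_pow_self).le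
  calc 2 ^ (A + 1) * C * (2 ^ a + n + 1) ^ C
      ≤ 2 ^ (A + 1) * 2 ^ C * 2 ^ (C * (a + L + 1)) :=
        Nat.mul_le_mul (Nat.mul_le_mul_left _ hC) hpow
    _ = 2 ^ (A + 1 + 2 * C + C * a + C * L) := by
        rw [← pow_add, ← pow_add]; ring_nf
    _ ≤ 2 ^ ((L + (c + A + 4 * C + 2)) ^ (c + A + 4 * C + 2)) :=
        Nat.pow_le_pow_right (by norm_num) (by simpa [ha] using glue_exponent_le A C c L)

/-! ## The glue -/

/-- **Glued split of `PMCorrelationGap`** (shape `C₁ → C₂ → C` for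
`ledger route edit --split PMCorrelationGap --glue-by`): free-fermion super-quasi-polynomial decay
(child `FreeFermionQPDecay`) and the colour-merging comparison (child `ColourMerging`, power form)
imply the target gap. -/
theorem pmCorrelationGap_of_subs
    (h₁ : ∀ c : ℕ, ∃ n₀ : ℕ, ∀ n ≥ n₀, ∀ (K : Matrix (Fin n × Fin n) (Fin n × Fin n) ℂ),
      (2 : ℝ) ^ ((Nat.log 2 n + c) ^ c) *
          ‖Literature.Computability.AlgebraicComplexity.permMass n
              (MvPolynomial.homogeneousComponent n
                (1 + Matrix.diagonal (fun e : Fin n × Fin n => MvPolynomial.X e) *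
                  K.map (fun a : ℂ => (MvPolynomial.C a : MvPolynomial (Fin n × Fin n) ℂ))).det)‖ ^ 2 ≤
        (n.factorial : ℝ) *
          Literature.Computability.AlgebraicComplexity.coeffNormSq n
            (MvPolynomial.homogeneousComponent n
              (1 + Matrix.diagonal (fun e : Fin n × Fin n => MvPolynomial.X e) *
                K.map (fun a : ℂ => (MvPolynomial.C a : MvPolynomial (Fin n × Fin n) ℂ))).det))
    (h₂ : ∃ A C : ℕ, ∀ (n R : ℕ) (K : Matrix (Fin R) (Fin R) ℂ) (κ : Fin R → Fin n × Fin n),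
      ∃ K' : Matrix (Fin n × Fin n) (Fin n × Fin n) ℂ,
        Literature.Computability.AlgebraicComplexity.permCorrSq n
              (MvPolynomial.homogeneousComponent n
                (1 + Matrix.diagonal (fun i => MvPolynomial.X (κ i)) *
                  K.map (fun a : ℂ => (MvPolynomial.C a : MvPolynomial (Fin n × Fin n) ℂ))).det) ^ (A + 1) ≤
          (C : ℝ) * ((R : ℝ) + n + 1) ^ C *
            Literature.Computability.AlgebraicComplexity.permCorrSq n
              (MvPolynomial.homogeneousComponent n
                (1 + Matrix.diagonal (fun e : Fin n × Fin n => MvPolynomial.X e) *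
                  K'.map (fun a : ℂ => (MvPolynomial.C a : MvPolynomial (Fin n × Fin n) ℂ))).det)) :
    XStatement := by
  obtain ⟨A, C, hCM⟩ := h₂
  unfold XStatement
  intro c
  obtain ⟨n₀, hn₀⟩ := h₁ (c + A + 4 * C + 2)
  refine ⟨n₀, fun n hn R hR K κ => ?_⟩
  obtain ⟨K', hK'⟩ := hCM n R K κ
  have hdec := hn₀ n hn K'
  -- abbreviations: the coloured form `P`, the read-once form `F`, their correlations
  set P := MvPolynomial.homogeneousComponent n
      (1 + Matrix.diagonal (fun i => MvPolynomial.X (κ i)) *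
        K.map (fun a : ℂ => (MvPolynomial.C a : MvPolynomial (Fin n × Fin n) ℂ))).det with hP
  set F := MvPolynomial.homogeneousComponent n
      (1 + Matrix.diagonal (fun e : Fin n × Fin n => MvPolynomial.X e) *
        K'.map (fun a : ℂ => (MvPolynomial.C a : MvPolynomial (Fin n × Fin n) ℂ))).det with hF
  set a : ℕ := (Nat.log 2 n + c) ^ c with ha
  set a' : ℕ := (Nat.log 2 n + (c + A + 4 * C + 2)) ^ (c + A + 4 * C + 2) with ha'
  set ρ : ℝ := permCorrSq n P with hρ
  set ρ' : ℝ := permCorrSq n F with hρ'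
  set N : ℝ := (n.factorial : ℝ) * coeffNormSq n P with hN
  have hN0 : 0 ≤ N := mul_nonneg (Nat.cast_nonneg _) (coeffNormSq_nonneg _)
  have hρ0 : 0 ≤ ρ := permCorrSq_nonneg _
  have hρ'0 : 0 ≤ ρ' := permCorrSq_nonneg _
  have hmass : ‖permMass n P‖ ^ 2 = ρ * N := (permCorrSq_mul_eq P).symm
  -- child 1 at `c' = c + A + 4C + 2`: `2^a' · ρ' ≤ 1`
  have h2a' : (0 : ℝ) < (2 : ℝ) ^ a' := pow_pos two_pos _
  have hρ'le : ρ' ≤ ((2 : ℝ) ^ a')⁻¹ := by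
    rw [hρ', permCorrSq_le_iff (inv_nonneg.2 h2a'.le), inv_mul_eq_div, le_div_iff₀ h2a']
    calc ‖permMass n F‖ ^ 2 * 2 ^ a' = 2 ^ a' * ‖permMass n F‖ ^ 2 := mul_comm _ _
      _ ≤ (n.factorial : ℝ) * coeffNormSq n F := hdec
  have h3 : (2 : ℝ) ^ a' * ρ' ≤ 1 := by
    calc (2 : ℝ) ^ a' * ρ' ≤ (2 : ℝ) ^ a' * ((2 : ℝ) ^ a')⁻¹ :=
          mul_le_mul_of_nonneg_left hρ'le h2a'.le
      _ = 1 := mul_inv_cancel₀ h2a'.ne'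
  -- the rank bound and the quasi-polynomial bookkeeping
  have hR' : (R : ℝ) ≤ (2 : ℝ) ^ a := by exact_mod_cast hR
  have hY : ((R : ℝ) + n + 1) ^ C ≤ ((2 : ℝ) ^ a + n + 1) ^ C :=
    pow_le_pow_left₀ (by positivity) (by linarith) C
  have hg : (2 : ℝ) ^ (A + 1) * C * ((2 : ℝ) ^ a + n + 1) ^ C ≤ (2 : ℝ) ^ a' := by
    have := glue_nat_bound A C c n
    exact_mod_cast this
  -- chain: `(2ρ)^(A+1) = 2^(A+1) ρ^(A+1) ≤ 2^(A+1) C (2^a+n+1)^C ρ' ≤ 2^a' ρ' ≤ 1`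
  have h1 : ρ ^ (A + 1) ≤ (C : ℝ) * ((2 : ℝ) ^ a + n + 1) ^ C * ρ' := by
    calc ρ ^ (A + 1) ≤ (C : ℝ) * ((R : ℝ) + n + 1) ^ C * ρ' := hK'
      _ ≤ (C : ℝ) * ((2 : ℝ) ^ a + n + 1) ^ C * ρ' := by
          apply mul_le_mul_of_nonneg_right _ hρ'0
          exact mul_le_mul_of_nonneg_left hY (Nat.cast_nonneg C)
  have hkey : (2 * ρ) ^ (A + 1) ≤ 1 := by
    calc (2 * ρ) ^ (A + 1) = (2 : ℝ) ^ (A + 1) * ρ ^ (A + 1) := mul_pow _ _ _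
      _ ≤ (2 : ℝ) ^ (A + 1) * ((C : ℝ) * ((2 : ℝ) ^ a + n + 1) ^ C * ρ') :=
          mul_le_mul_of_nonneg_left h1 (pow_nonneg zero_le_two _)
      _ = ((2 : ℝ) ^ (A + 1) * C * ((2 : ℝ) ^ a + n + 1) ^ C) * ρ' := by ring
      _ ≤ (2 : ℝ) ^ a' * ρ' := mul_le_mul_of_nonneg_right hg hρ'0
      _ ≤ 1 := h3
  have hρhalf : 2 * ρ ≤ 1 := by
    have h := (pow_le_pow_iff_left₀ (by positivity : (0 : ℝ) ≤ 2 * ρ) zero_le_one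
      (Nat.succ_ne_zero A)).1 (by simpa using hkey)
    exact h
  -- conclusion: `2‖permMass P‖² = 2ρN ≤ N`
  rw [hmass]
  nlinarith [hρhalf, hN0]

/-! ## The route's exponential rung implies child 1 -/

/-- **`ReadOnceDecay → FreeFermionQPDecay`**: the route's rank-2 crux (exponential decay of the
free-fermion overlap, `corr² ≤ C·θⁿ`) implies child 1 (decay faster than every quasi-polynomial),
because `2·C·(2^((log₂ n + c)^c) + n + 1)^C·θⁿ ≤ 1` eventually
(`eventually_quasipoly_mul_geom_le_one`). So a proof of `ReadOnceDecay` closes child 1. -/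
theorem freeFermionQPDecay_of_readOnceDecay (h : ReadOnceDecay) :
    ∀ c : ℕ, ∃ n₀ : ℕ, ∀ n ≥ n₀, ∀ (K : Matrix (Fin n × Fin n) (Fin n × Fin n) ℂ),
      (2 : ℝ) ^ ((Nat.log 2 n + c) ^ c) *
          ‖Literature.Computability.AlgebraicComplexity.permMass n
              (MvPolynomial.homogeneousComponent n
                (1 + Matrix.diagonal (fun e : Fin n × Fin n => MvPolynomial.X e) *
                  K.map (fun a : ℂ => (MvPolynomial.C a : MvPolynomial (Fin n × Fin n) ℂ))).det)‖ ^ 2 ≤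
        (n.factorial : ℝ) *
          Literature.Computability.AlgebraicComplexity.coeffNormSq n
            (MvPolynomial.homogeneousComponent n
              (1 + Matrix.diagonal (fun e : Fin n × Fin n => MvPolynomial.X e) *
                K.map (fun a : ℂ => (MvPolynomial.C a : MvPolynomial (Fin n × Fin n) ℂ))).det) := by
  obtain ⟨C, θ, hθ0, hθ1, hRO⟩ := h
  intro c
  obtain ⟨n₀, hn₀⟩ := Theorems.FreeFermionCLL.eventually_quasipoly_mul_geom_le_one C c hθ0 hθ1
  refine ⟨n₀, fun n hn K => ?_⟩
  have hlaw := hRO n K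
  have hkey := hn₀ n hn
  set F := MvPolynomial.homogeneousComponent n
      (1 + Matrix.diagonal (fun e : Fin n × Fin n => MvPolynomial.X e) *
        K.map (fun a : ℂ => (MvPolynomial.C a : MvPolynomial (Fin n × Fin n) ℂ))).det with hF
  set N : ℝ := (n.factorial : ℝ) * coeffNormSq n F with hN
  set a : ℕ := (Nat.log 2 n + c) ^ c with ha
  have hN0 : 0 ≤ N := mul_nonneg (Nat.cast_nonneg _) (coeffNormSq_nonneg _)
  have hθn : 0 ≤ θ ^ n := pow_nonneg hθ0.le n
  by_cases hC : C = 0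
  · subst hC
    have h0 : ‖permMass n F‖ ^ 2 ≤ 0 := by simpa using hlaw
    have h0' : ‖permMass n F‖ ^ 2 = 0 := le_antisymm h0 (sq_nonneg _)
    rw [h0', mul_zero]
    exact hN0
  · have hC1 : 1 ≤ C := Nat.one_le_iff_ne_zero.2 hC
    have hb : (1 : ℝ) ≤ (2 : ℝ) ^ a + n + 1 := by
      have : (1 : ℝ) ≤ (2 : ℝ) ^ a := one_le_pow₀ (by norm_num)
      have : (0 : ℝ) ≤ n := Nat.cast_nonneg n
      linarith
    have h2a : (2 : ℝ) ^ a ≤ ((2 : ℝ) ^ a + n + 1) ^ C := by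
      calc (2 : ℝ) ^ a = ((2 : ℝ) ^ a) ^ 1 := (pow_one _).symm
        _ ≤ ((2 : ℝ) ^ a + n + 1) ^ 1 := by
            rw [pow_one, pow_one]; have : (0 : ℝ) ≤ n := Nat.cast_nonneg n; linarith
        _ ≤ ((2 : ℝ) ^ a + n + 1) ^ C := pow_le_pow_right₀ hb hC1
    have hCθN : 0 ≤ (C : ℝ) * θ ^ n * N := by positivity
    calc (2 : ℝ) ^ a * ‖permMass n F‖ ^ 2 ≤ (2 : ℝ) ^ a * ((C : ℝ) * θ ^ n * N) :=
          mul_le_mul_of_nonneg_left hlaw (by positivity)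
      _ ≤ ((2 : ℝ) ^ a + n + 1) ^ C * ((C : ℝ) * θ ^ n * N) :=
          mul_le_mul_of_nonneg_right h2a hCθN
      _ = (1 / 2) * (2 * (C : ℝ) * ((2 : ℝ) ^ a + n + 1) ^ C * θ ^ n) * N := by ring
      _ ≤ (1 / 2) * 1 * N := by
          apply mul_le_mul_of_nonneg_right _ hN0
          exact mul_le_mul_of_nonneg_left hkey (by norm_num)
      _ ≤ N := by linarith


/-- The glue by name: the two children imply the crux. -/
theorem xStatement_of_children (h₁ : FreeFermionQPDecay) (h₂ : ColourMerging) :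
    XStatement :=
  pmCorrelationGap_of_subs h₁ h₂

/-! ## §2 The Fekete line for child 1 (`FreeFermionQPDecay`) -/

/-- The degree-`n` component of the read-once (free-fermion) form with kernel `K` on the `n × n` board. -/
local notation "FF(" n ", " K ")" =>
  MvPolynomial.homogeneousComponent n
    (Matrix.det (1 + Matrix.diagonal (fun e : Fin n × Fin n => MvPolynomial.X e) *
      Matrix.map K (fun a : ℂ => (MvPolynomial.C a : MvPolynomial (Fin n × Fin n) ℂ))))

/-- The free-fermion overlap `s(n) = sup_K permCorrSq(FF_K^(n))`. -/
local notation "ffSup(" n ")" =>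
  ⨆ K : Matrix (Fin n × Fin n) (Fin n × Fin n) ℂ, permCorrSq n (FF(n, K))

/-- **stub (hardest, size L)** — sub-multiplicativity of the free-fermion overlap over board sizes. -/
theorem stub_subMult :
    ∀ (n m : ℕ) (K : Matrix (Fin (n + m) × Fin (n + m)) (Fin (n + m) × Fin (n + m)) ℂ),
      permCorrSq (n + m) (FF(n + m, K)) ≤ ffSup(n) * ffSup(m) := by
  sorry

/-- **stub (size M, computational)** — one finite level at which free fermions are at angle ≥ 45°
from the bosons. -/
theorem stub_thresholdHalf : ∃ n₀ : ℕ, 1 ≤ n₀ ∧ ffSup(n₀) ≤ 1 / 2 := by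
  sorry

/-- Every overlap is bounded by the level's supremum. -/
theorem le_ffSup (n : ℕ) (K : Matrix (Fin n × Fin n) (Fin n × Fin n) ℂ) :
    permCorrSq n (FF(n, K)) ≤ ffSup(n) :=
  le_ciSup (f := fun K : Matrix (Fin n × Fin n) (Fin n × Fin n) ℂ => permCorrSq n (FF(n, K)))
    ⟨1, by rintro _ ⟨K', rfl⟩; exact permCorrSq_le_one _⟩ K

theorem ffSup_nonneg (n : ℕ) : 0 ≤ ffSup(n) :=
  Real.iSup_nonneg fun _ => permCorrSq_nonneg _

theorem ffSup_le_one (n : ℕ) : ffSup(n) ≤ 1 :=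
  Real.iSup_le (fun _ => permCorrSq_le_one _) zero_le_one

/-- **Composition (Fekete)**: the two stubs imply the piece. -/
theorem freeFermionQPDecay_of
    (h₁ : ∀ (n m : ℕ) (K : Matrix (Fin (n + m) × Fin (n + m)) (Fin (n + m) × Fin (n + m)) ℂ),
      permCorrSq (n + m) (FF(n + m, K)) ≤ ffSup(n) * ffSup(m))
    (h₂ : ∃ n₀ : ℕ, 1 ≤ n₀ ∧ ffSup(n₀) ≤ 1 / 2) :
    FreeFermionQPDecay := by
  obtain ⟨n₀, hn₀, hhalf⟩ := h₂
  -- the overlap function and its basic properties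
  set s : ℕ → ℝ := fun k => ffSup(k) with hs
  have hs0 : ∀ k, 0 ≤ s k := fun k => ffSup_nonneg k
  have hs1 : ∀ k, s k ≤ 1 := fun k => ffSup_le_one k
  have hsub : ∀ k j, s (k + j) ≤ s k * s j := fun k j =>
    Real.iSup_le (fun K => h₁ k j K) (mul_nonneg (hs0 k) (hs0 j))
  -- Fekete: `s (n₀ q) ≤ (1/2)^q`
  have hblock : ∀ q : ℕ, s (n₀ * q) ≤ (1 / 2) ^ q := by
    intro q
    induction q with
    | zero => simpa using hs1 0
    | succ q ih =>
        calc s (n₀ * (q + 1)) = s (n₀ * q + n₀) := by rw [Nat.mul_succ]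
          _ ≤ s (n₀ * q) * s n₀ := hsub _ _
          _ ≤ (1 / 2) ^ q * (1 / 2) :=
              mul_le_mul ih hhalf (hs0 _) (pow_nonneg (by norm_num) _)
          _ = (1 / 2) ^ (q + 1) := (pow_succ _ _).symm
  have hdiv : ∀ n : ℕ, s n ≤ (1 / 2) ^ (n / n₀) := by
    intro n
    have h := hsub (n₀ * (n / n₀)) (n % n₀)
    rw [Nat.div_add_mod] at h
    calc s n ≤ s (n₀ * (n / n₀)) * s (n % n₀) := h
      _ ≤ (1 / 2) ^ (n / n₀) * 1 :=
          mul_le_mul (hblock _) (hs1 _) (hs0 _) (pow_nonneg (by norm_num) _)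
      _ = (1 / 2) ^ (n / n₀) := mul_one _
  -- `(log₂ n + c)^c ≤ n / n₀` eventually
  intro c
  have hn₀pos : (0 : ℝ) < n₀ := by exact_mod_cast hn₀
  have hev : ∀ᶠ n : ℕ in atTop,
      (((Nat.log 2 n + c) ^ c : ℕ) : ℝ) / (n : ℝ) < 1 / (2 * n₀) :=
    (Theorems.FreeFermionCLL.tendsto_natLog_add_pow_div_atTop c).eventually
      (gt_mem_nhds (by positivity))
  obtain ⟨N₁, hN₁⟩ := eventually_atTop.1 hev
  refine ⟨max N₁ 1, fun n hn K => ?_⟩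
  have hnN : N₁ ≤ n := le_trans (le_max_left _ _) hn
  have hn1 : 1 ≤ n := le_trans (le_max_right _ _) hn
  set a : ℕ := (Nat.log 2 n + c) ^ c with ha
  -- from `a/n < 1/(2 n₀)` and `n ≥ 1`: `a * n₀ ≤ n`, hence `a ≤ n / n₀`
  have hlt := hN₁ n hnN
  have hnpos : (0 : ℝ) < n := by exact_mod_cast hn1
  have hreal : (a : ℝ) * n₀ ≤ n := by
    rw [div_lt_div_iff₀ hnpos (by positivity)] at hlt
    nlinarith [hlt]
  have hnat : a * n₀ ≤ n := by exact_mod_cast hreal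
  have haq : a ≤ n / n₀ := (Nat.le_div_iff_mul_le hn₀).2 hnat
  -- `permCorrSq ≤ s n ≤ (1/2)^(n/n₀) ≤ (1/2)^a = (2^a)⁻¹`
  have hcorr : permCorrSq n (FF(n, K)) ≤ ((2 : ℝ) ^ a)⁻¹ := by
    calc permCorrSq n (FF(n, K)) ≤ s n := le_ffSup n K
      _ ≤ (1 / 2) ^ (n / n₀) := hdiv n
      _ ≤ (1 / 2) ^ a := pow_le_pow_of_le_one (by norm_num) (by norm_num) haq
      _ = ((2 : ℝ) ^ a)⁻¹ := by rw [one_div, inv_pow]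
  have h2a : (0 : ℝ) < (2 : ℝ) ^ a := pow_pos two_pos _
  rw [permCorrSq_le_iff (inv_nonneg.2 h2a.le), inv_mul_eq_div, le_div_iff₀ h2a] at hcorr
  calc (2 : ℝ) ^ a * ‖permMass n (FF(n, K))‖ ^ 2 = ‖permMass n (FF(n, K))‖ ^ 2 * 2 ^ a := mul_comm _ _
    _ ≤ (n.factorial : ℝ) * coeffNormSq n (FF(n, K)) := hcorr


/-! ## §3 The amplification line for child 2 (`ColourMerging`) -/

/-- The degree-`n` component of the coloured principal-minor form `det(I_R + diag(x∘κ)·K)`. -/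
local notation "PM(" n ", " R ", " K ", " κ ")" =>
  MvPolynomial.homogeneousComponent n
    (Matrix.det (1 + Matrix.diagonal (fun i : Fin R => MvPolynomial.X (κ i)) *
      Matrix.map K (fun a : ℂ => (MvPolynomial.C a : MvPolynomial (Fin n × Fin n) ℂ))))

/-- **stub (structural, size L)** — amplification by symmetrisation: from correlation `ρ` at total
rank `R`, for every `k ≥ 1` a form of total rank `≤ (k(R+n+2))^B` with `k·ρ·(1 − ρ̃) ≤ 1 − ρ`. -/
theorem stub_amplify :
    ∃ B : ℕ, ∀ (n R : ℕ) (K : Matrix (Fin R) (Fin R) ℂ) (κ : Fin R → Fin n × Fin n) (k : ℕ),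
      1 ≤ k → ∃ R' : ℕ, R' ≤ (k * (R + n + 2)) ^ B ∧
        ∃ (K₁ : Matrix (Fin R') (Fin R') ℂ) (κ₁ : Fin R' → Fin n × Fin n),
          (k : ℝ) * permCorrSq n (PM(n, R, K, κ)) * (1 - permCorrSq n (PM(n, R', K₁, κ₁))) ≤
            1 - permCorrSq n (PM(n, R, K, κ)) := by
  sorry

/-- **stub (hardest — the open content, size XL)** — good correlators force free-fermion overlap. -/
theorem stub_goodCorrelatorsForceFF :
    ∃ C : ℕ, ∀ (n R : ℕ) (K : Matrix (Fin R) (Fin R) ℂ) (κ : Fin R → Fin n × Fin n),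
      (1 / 2 : ℝ) ≤ permCorrSq n (PM(n, R, K, κ)) →
        ∃ K' : Matrix (Fin n × Fin n) (Fin n × Fin n) ℂ,
          (1 : ℝ) ≤ (C : ℝ) * ((R : ℝ) + n + 1) ^ C * permCorrSq n (FF(n, K')) := by
  sorry

/-- **Composition**: amplification + the comparison for good correlators imply the piece, with
power `A = B·C` and constant `C·3^(BC)·2^((B+1)C) + (B+1)C + 1`. -/
theorem colourMerging_of
    (h₁ : ∃ B : ℕ, ∀ (n R : ℕ) (K : Matrix (Fin R) (Fin R) ℂ) (κ : Fin R → Fin n × Fin n) (k : ℕ),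
      1 ≤ k → ∃ R' : ℕ, R' ≤ (k * (R + n + 2)) ^ B ∧
        ∃ (K₁ : Matrix (Fin R') (Fin R') ℂ) (κ₁ : Fin R' → Fin n × Fin n),
          (k : ℝ) * permCorrSq n (PM(n, R, K, κ)) * (1 - permCorrSq n (PM(n, R', K₁, κ₁))) ≤
            1 - permCorrSq n (PM(n, R, K, κ)))
    (h₂ : ∃ C : ℕ, ∀ (n R : ℕ) (K : Matrix (Fin R) (Fin R) ℂ) (κ : Fin R → Fin n × Fin n),
      (1 / 2 : ℝ) ≤ permCorrSq n (PM(n, R, K, κ)) →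
        ∃ K' : Matrix (Fin n × Fin n) (Fin n × Fin n) ℂ,
          (1 : ℝ) ≤ (C : ℝ) * ((R : ℝ) + n + 1) ^ C * permCorrSq n (FF(n, K'))) :
    ColourMerging := by
  obtain ⟨B, hamp⟩ := h₁
  obtain ⟨C₁, hgood⟩ := h₂
  set C₀ : ℕ := C₁ * 3 ^ (B * C₁) * 2 ^ ((B + 1) * C₁) + (B + 1) * C₁ + 1 with hC₀
  refine ⟨B * C₁, C₀, fun n R K κ => ?_⟩
  set ρ : ℝ := permCorrSq n (PM(n, R, K, κ)) with hρ
  have hρ0 : 0 ≤ ρ := permCorrSq_nonneg _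
  have hρ1 : ρ ≤ 1 := permCorrSq_le_one _
  have hbase1 : (1 : ℝ) ≤ (R : ℝ) + n + 1 := by
    have : (0 : ℝ) ≤ R := Nat.cast_nonneg R
    have : (0 : ℝ) ≤ n := Nat.cast_nonneg n
    linarith
  by_cases hρz : ρ = 0
  · -- trivial case: the left-hand side vanishes
    refine ⟨0, ?_⟩
    rw [hρz, zero_pow (Nat.succ_ne_zero _)]
    exact mul_nonneg (mul_nonneg (Nat.cast_nonneg _) (pow_nonneg (by linarith) _))
      (permCorrSq_nonneg _)
  · have hρpos : 0 < ρ := lt_of_le_of_ne hρ0 (Ne.symm hρz)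
    -- amplification parameter `k = ⌈2/ρ⌉`
    set k : ℕ := ⌈(2 : ℝ) / ρ⌉₊ with hk
    have h2ρ : (0 : ℝ) < 2 / ρ := by positivity
    have hk1 : 1 ≤ k := Nat.one_le_iff_ne_zero.2 (Nat.pos_iff_ne_zero.1 (Nat.ceil_pos.2 h2ρ))
    have hk2 : (2 : ℝ) / ρ ≤ k := Nat.le_ceil _
    have hk3 : (k : ℝ) ≤ 2 / ρ + 1 := (Nat.ceil_lt_add_one h2ρ.le).le
    obtain ⟨R', hR', K₁, κ₁, hineq⟩ := hamp n R K κ k hk1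
    set ρ₁ : ℝ := permCorrSq n (PM(n, R', K₁, κ₁)) with hρ₁
    have hρ₁1 : ρ₁ ≤ 1 := permCorrSq_le_one _
    -- the amplified form is a good correlator: `ρ₁ ≥ 1/2`
    have hkρ : (2 : ℝ) ≤ (k : ℝ) * ρ := by
      have := mul_le_mul_of_nonneg_right hk2 hρ0
      rwa [div_mul_cancel₀ _ hρz] at this
    have hgoodρ₁ : (1 / 2 : ℝ) ≤ ρ₁ := by
      have h1 : (k : ℝ) * ρ * (1 - ρ₁) ≤ 1 := le_trans hineq (by linarith)
      have h2 : 2 * (1 - ρ₁) ≤ (k : ℝ) * ρ * (1 - ρ₁) :=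
        mul_le_mul_of_nonneg_right hkρ (by linarith)
      linarith
    obtain ⟨K', hK'⟩ := hgood n R' K₁ κ₁ hgoodρ₁
    refine ⟨K', ?_⟩
    set f : ℝ := permCorrSq n (FF(n, K')) with hf
    have hf0 : 0 ≤ f := permCorrSq_nonneg _
    -- bookkeeping quantities
    set X : ℝ := (R : ℝ) + n + 2 with hX
    set T : ℝ := (k : ℝ) * X with hT
    have hX1 : (1 : ℝ) ≤ X := by linarith
    have hX0 : (0 : ℝ) ≤ X := by linarith
    have hk1r : (1 : ℝ) ≤ k := by exact_mod_cast hk1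
    have hT1 : (1 : ℝ) ≤ T := by
      calc (1 : ℝ) = 1 * 1 := (mul_one 1).symm
        _ ≤ (k : ℝ) * X := mul_le_mul hk1r hX1 zero_le_one (by linarith)
    have hTB : (1 : ℝ) ≤ T ^ B := one_le_pow₀ hT1
    have hR'le : (R' : ℝ) ≤ T ^ B := by
      have : ((R' : ℕ) : ℝ) ≤ (((k * (R + n + 2)) ^ B : ℕ) : ℝ) := by exact_mod_cast hR'
      simpa [hT, hX] using this
    -- (i) `R' + n + 1 ≤ T^B · X`
    have h_i : (R' : ℝ) + n + 1 ≤ T ^ B * X := by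
      have hn0 : (0 : ℝ) ≤ n := Nat.cast_nonneg n
      have hR0 : (0 : ℝ) ≤ R := Nat.cast_nonneg R
      have hTB0 : (0 : ℝ) ≤ T ^ B := by linarith
      calc (R' : ℝ) + n + 1 ≤ T ^ B + (n + 1) := by linarith
        _ ≤ T ^ B + T ^ B * (n + 1) + T ^ B * R := by nlinarith
        _ = T ^ B * X := by rw [hX]; ring
    -- (ii) `ρ · T ≤ 3 · X`
    have h_ii : ρ * T ≤ 3 * X := by
      have hρk : ρ * k ≤ 3 := by
        calc ρ * k ≤ ρ * (2 / ρ + 1) := mul_le_mul_of_nonneg_left hk3 hρ0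
          _ = 2 + ρ := by field_simp
          _ ≤ 3 := by linarith
      calc ρ * T = ρ * k * X := by rw [hT]; ring
        _ ≤ 3 * X := mul_le_mul_of_nonneg_right hρk hX0
    -- (iii) `ρ^B · (R' + n + 1) ≤ 3^B · X^(B+1)`
    have h_iii : ρ ^ B * ((R' : ℝ) + n + 1) ≤ (3 : ℝ) ^ B * X ^ (B + 1) := by
      calc ρ ^ B * ((R' : ℝ) + n + 1) ≤ ρ ^ B * (T ^ B * X) :=
            mul_le_mul_of_nonneg_left h_i (pow_nonneg hρ0 B)
        _ = (ρ * T) ^ B * X := by ring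
        _ ≤ (3 * X) ^ B * X :=
            mul_le_mul_of_nonneg_right (pow_le_pow_left₀ (by positivity) h_ii B) hX0
        _ = (3 : ℝ) ^ B * X ^ (B + 1) := by ring
    -- (iv) raise to the power `C₁`
    have h_iv : ρ ^ (B * C₁) * ((R' : ℝ) + n + 1) ^ C₁ ≤ (3 : ℝ) ^ (B * C₁) * X ^ ((B + 1) * C₁) := by
      have hnn : 0 ≤ ρ ^ B * ((R' : ℝ) + n + 1) := mul_nonneg (pow_nonneg hρ0 B) (by positivity)
      calc ρ ^ (B * C₁) * ((R' : ℝ) + n + 1) ^ C₁ = (ρ ^ B * ((R' : ℝ) + n + 1)) ^ C₁ := by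
            rw [mul_pow, ← pow_mul]
        _ ≤ ((3 : ℝ) ^ B * X ^ (B + 1)) ^ C₁ := pow_le_pow_left₀ hnn h_iii C₁
        _ = (3 : ℝ) ^ (B * C₁) * X ^ ((B + 1) * C₁) := by
            rw [mul_pow, ← pow_mul, ← pow_mul]
    -- (v) unwind the comparison
    have h_v : ρ ^ (B * C₁) ≤ (C₁ : ℝ) * (3 : ℝ) ^ (B * C₁) * X ^ ((B + 1) * C₁) * f := by
      have hρBC : 0 ≤ ρ ^ (B * C₁) := pow_nonneg hρ0 _
      calc ρ ^ (B * C₁) = ρ ^ (B * C₁) * 1 := (mul_one _).symm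
        _ ≤ ρ ^ (B * C₁) * ((C₁ : ℝ) * ((R' : ℝ) + n + 1) ^ C₁ * f) :=
            mul_le_mul_of_nonneg_left hK' hρBC
        _ = (C₁ : ℝ) * (ρ ^ (B * C₁) * ((R' : ℝ) + n + 1) ^ C₁) * f := by ring
        _ ≤ (C₁ : ℝ) * ((3 : ℝ) ^ (B * C₁) * X ^ ((B + 1) * C₁)) * f := by
            apply mul_le_mul_of_nonneg_right _ hf0
            exact mul_le_mul_of_nonneg_left h_iv (Nat.cast_nonneg _)
        _ = (C₁ : ℝ) * (3 : ℝ) ^ (B * C₁) * X ^ ((B + 1) * C₁) * f := by ring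
    -- (vi) `X ≤ 2 (R + n + 1)` and the final constants
    have h_vi : X ^ ((B + 1) * C₁) ≤ (2 : ℝ) ^ ((B + 1) * C₁) * ((R : ℝ) + n + 1) ^ ((B + 1) * C₁) := by
      rw [← mul_pow]
      exact pow_le_pow_left₀ hX0 (by rw [hX]; linarith) _
    have hconst : (C₁ : ℝ) * (3 : ℝ) ^ (B * C₁) * (2 : ℝ) ^ ((B + 1) * C₁) ≤ C₀ := by
      have : C₁ * 3 ^ (B * C₁) * 2 ^ ((B + 1) * C₁) ≤ C₀ := by rw [hC₀]; omega
      exact_mod_cast this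
    have hexp : ((R : ℝ) + n + 1) ^ ((B + 1) * C₁) ≤ ((R : ℝ) + n + 1) ^ C₀ :=
      pow_le_pow_right₀ hbase1 (by rw [hC₀]; omega)
    calc ρ ^ (B * C₁ + 1) ≤ ρ ^ (B * C₁) := pow_le_pow_of_le_one hρ0 hρ1 (Nat.le_succ _)
      _ ≤ (C₁ : ℝ) * (3 : ℝ) ^ (B * C₁) * X ^ ((B + 1) * C₁) * f := h_v
      _ ≤ (C₁ : ℝ) * (3 : ℝ) ^ (B * C₁) *
            ((2 : ℝ) ^ ((B + 1) * C₁) * ((R : ℝ) + n + 1) ^ ((B + 1) * C₁)) * f := by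
          apply mul_le_mul_of_nonneg_right _ hf0
          exact mul_le_mul_of_nonneg_left h_vi (by positivity)
      _ = ((C₁ : ℝ) * (3 : ℝ) ^ (B * C₁) * (2 : ℝ) ^ ((B + 1) * C₁)) *
            ((R : ℝ) + n + 1) ^ ((B + 1) * C₁) * f := by ring
      _ ≤ (C₀ : ℝ) * ((R : ℝ) + n + 1) ^ C₀ * f := by
          apply mul_le_mul_of_nonneg_right _ hf0
          exact mul_le_mul hconst hexp (by positivity) (Nat.cast_nonneg _)


/-! ## §4 The line closes the crux by name -/

/-- **`PMCorrelationGap_of`** — the registered stubs imply the crux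
(Fekete ∘ symmetrisation-amplification ∘ quasi-polynomial glue); the only theorem of this file whose
conclusion is the route decl. -/
theorem PMCorrelationGap_of : PMCorrelationGap :=
  (xStatement_iff).1
    (xStatement_of_children (freeFermionQPDecay_of stub_subMult stub_thresholdHalf)
      (colourMerging_of stub_amplify stub_goodCorrelatorsForceFF))

/-- The same composition with the four stub statements as explicit hypotheses (concludes the
verbatim copy `XStatement`). -/
theorem xStatement_of_stubs
    (h₁ : ∀ (n m : ℕ) (K : Matrix (Fin (n + m) × Fin (n + m)) (Fin (n + m) × Fin (n + m)) ℂ),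
      permCorrSq (n + m) (FF(n + m, K)) ≤ ffSup(n) * ffSup(m))
    (h₂ : ∃ n₀ : ℕ, 1 ≤ n₀ ∧ ffSup(n₀) ≤ 1 / 2)
    (h₃ : ∃ B : ℕ, ∀ (n R : ℕ) (K : Matrix (Fin R) (Fin R) ℂ) (κ : Fin R → Fin n × Fin n) (k : ℕ),
      1 ≤ k → ∃ R' : ℕ, R' ≤ (k * (R + n + 2)) ^ B ∧
        ∃ (K₁ : Matrix (Fin R') (Fin R') ℂ) (κ₁ : Fin R' → Fin n × Fin n),
          (k : ℝ) * permCorrSq n (PM(n, R, K, κ)) * (1 - permCorrSq n (PM(n, R', K₁, κ₁))) ≤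
            1 - permCorrSq n (PM(n, R, K, κ)))
    (h₄ : ∃ C : ℕ, ∀ (n R : ℕ) (K : Matrix (Fin R) (Fin R) ℂ) (κ : Fin R → Fin n × Fin n),
      (1 / 2 : ℝ) ≤ permCorrSq n (PM(n, R, K, κ)) →
        ∃ K' : Matrix (Fin n × Fin n) (Fin n × Fin n) ℂ,
          (1 : ℝ) ≤ (C : ℝ) * ((R : ℝ) + n + 1) ^ C * permCorrSq n (FF(n, K'))) :
    XStatement :=
  xStatement_of_children (freeFermionQPDecay_of h₁ h₂) (colourMerging_of h₃ h₄)

end Summit.ValiantsHypothesis.ValiantsHypothesis.Cruxes.PMCorrelationGap.ReadOnceSeam
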